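import Mathlib.LinearAlgebra.Matrix.Determinant.Basic
import Literature.NumberTheory.EllipticCurves.AnalyticRank
import Literature.NumberTheory.EllipticCurves.Heights
import HarnessLib

/-!
# Higher Gross–Zagier data for an elliptic curve over `ℚ` (posited interface)

Target: `Summits/BirchSwinnertonDyer/Theorems/HigherGrossZagier/Defs.lean` (a route-posited NEW
OBJECT, hence problem-side per D-0014; review of p2749). Definition request
`defn-HigherGrossZagierDatum` (literature item wi-03668; wanted by route
`BirchSwinnertonDyer/HigherGrossZagier`, items stmt-BirchSwinnertonDyer-0258 / -0147).

## Content

`HigherGrossZagierDatum W r` — a **rank-`r` Gross–Zagier datum** for a Weierstrass curve `W/ℚ`: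
`r` rational points `P₁, …, P_r ∈ E(ℚ)`, a constant `c > 0`, and the identity
`L^{(r)}(E, 1) / r! = c · det (⟨Pᵢ, Pⱼ⟩)_{i,j}` between the `r`-th Taylor coefficient of the
entire L-function at `s = 1` (`WeierstrassCurve.entireLFunction`, `AnalyticRank.lean`) and the
Néron–Tate regulator determinant of the `Pᵢ` (`WeierstrassCurve.Affine.Point.heightPairing`,
`Heights.lean`, pairing `⟨P, Q⟩ = (ĥ(P+Q) - ĥ P - ĥ Q)/2`).

This is an *interface* (a structure that may or may not be inhabited), NOT an existence claim.
**Inhabitation profile (read before use).** Whenever `L^{(r)}(E,1) = 0` — in particular for every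
`0 < r < r_an(E)` — a datum exists *trivially* (`trivialDatum`: all `Pᵢ = 0`, `c = 1`, both sides
of the formula vanish), so a bare hypothesis `D : HigherGrossZagierDatum W r` carries information
only in the regime `L^{(r)}(E,1) ≠ 0`, i.e. `r = r_an(E)` (where `det_ne_zero` applies);
consumers must not read "`∃` datum" as progress by itself.
* `r = 1`, `r_an(E) = 1`: a datum should come from the Gross–Zagier formula over an imaginary
  quadratic `K` (`Literature.NumberTheory.EllipticCurves.GrossZagierFormula` / `Literature.NumberTheory.EllipticCurves.gross_zagier`, `BSDHeegnerPoints.lean`) combined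
  with a quadratic twist `E^D` with `L(E^D, 1) ≠ 0` (Bump–Friedberg–Hoffstein / Murty–Murty) to
  descend `L'(E/K,1) = L'(E,1) L(E^D,1)` to `ℚ`, and `heightPairing P P = ĥ P`
  (`heightPairing_self`, `Heights.lean`); this CONSTRUCTION is a separate route item, not
  asserted here.
* `r = r_an(E)` in general: inhabitation with `c = Ω_E · ∏ c_p · #Ш / #E(ℚ)_tors²` and `Pᵢ` a
  basis of `E(ℚ)/tors` is the leading-term Birch–Swinnerton-Dyer conjecture
  (Birch–Swinnerton-Dyer 1965; Wiles, Clay 2006), and any "higher Gross–Zagier formula"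
  producing such a datum for `r ≥ 2` is open (Yuan–Zhang–Zhang 2013 and Darmon–Rotger 2017 give
  `p`-adic / derivative-of-families analogues, not this archimedean statement).

API: `leadingLCoeff_eq` (for `r = r_an` the left side is `W.leadingLCoeff`), `det_ne_zero`
(if `L^{(r)}(E,1) ≠ 0` the regulator determinant of the datum is non-zero — the input to the Gram
argument `r ≤ rank E(ℚ)`, which is route work), `regulatorMatrix_isSymm` given symmetry of the
pairing.

## Sources

* B. Gross, D. Zagier, *Heegner points and derivatives of L-series*, Invent. Math. 84 (1986),
  225–320: Thm. I.6.3, §V.2.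
* B. Birch, H. P. F. Swinnerton-Dyer, *Notes on elliptic curves II*, Crelle 218 (1965); A. Wiles,
  *The Birch and Swinnerton-Dyer conjecture*, Clay 2006 (leading-term formula).
* X. Yuan, S.-W. Zhang, W. Zhang, *The Gross–Zagier formula on Shimura curves*, Ann. Math. Stud.
  184 (2013).
-/

noncomputable section

open scoped Classical

namespace Literature.EllArith

open WeierstrassCurve WeierstrassCurve.Affine.Point

/-- A **rank-`r` (higher) Gross–Zagier datum** for `W/ℚ`: points `P : Fin r → E(ℚ)`, a constant
`c > 0` and the formula `L^{(r)}(E,1)/r! = c · det(⟨Pᵢ,Pⱼ⟩_{NT})`. Posited interface for the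
route `HigherGrossZagier` — no existence is asserted. Trivially inhabited whenever
`L^{(r)}(E,1) = 0` (`trivialDatum`), so it carries information only for `r = r_an(E)`; there it is
the shape of the Gross–Zagier formula (`r = 1`, Gross–Zagier 1986, Thm. I.6.3, §V.2, via
`Literature.NumberTheory.EllipticCurves.GrossZagierFormula` plus a non-vanishing twist) and, conjecturally, of the BSD leading term.
[cite: GrossZagier1986, Thm. I.6.3 and §V.2 (the case r = 1)] -/
structure HigherGrossZagierDatum (W : WeierstrassCurve ℚ) (r : ℕ) where
  /-- the `r` rational points whose Néron–Tate regulator computes `L^{(r)}(E,1)/r!` -/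
  P : Fin r → W.toAffine.Point
  /-- the (positive, typically transcendental) proportionality constant -/
  c : ℝ
  /-- positivity of the constant -/
  c_pos : 0 < c
  /-- the higher Gross–Zagier formula `L^{(r)}(E,1)/r! = c · det(⟨Pᵢ,Pⱼ⟩)` -/
  formula : iteratedDeriv r W.entireLFunction 1 / (r.factorial : ℂ) =
    ((c * (Matrix.of fun i j => (P i).heightPairing (P j)).det : ℝ) : ℂ)

namespace HigherGrossZagierDatum

variable {W : WeierstrassCurve ℚ} {r : ℕ}

/-- The Néron–Tate regulator matrix `(⟨Pᵢ, Pⱼ⟩)_{i,j}` of the datum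
(Gross–Zagier 1986, §V.2; Silverman AEC VIII.9). [cite: GrossZagier1986, §V.2] -/
def regulatorMatrix (D : HigherGrossZagierDatum W r) : Matrix (Fin r) (Fin r) ℝ :=
  Matrix.of fun i j => (D.P i).heightPairing (D.P j)

/-- The formula of the datum in terms of `regulatorMatrix`. [cite: GrossZagier1986, Thm. I.6.3] -/
theorem formula_eq (D : HigherGrossZagierDatum W r) :
    iteratedDeriv r W.entireLFunction 1 / (r.factorial : ℂ) =
      ((D.c * D.regulatorMatrix.det : ℝ) : ℂ) :=
  D.formula

/-- For `r = r_an(E)` the left-hand side of the formula is the leading Taylor coefficient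
`W.leadingLCoeff` of `L(E,s)` at `s = 1` (Birch–Swinnerton-Dyer 1965; the quantity predicted by
BSD). [cite: BirchSwinnertonDyer1965] -/
theorem leadingLCoeff_eq (D : HigherGrossZagierDatum W W.analyticRank) :
    W.leadingLCoeff = ((D.c * D.regulatorMatrix.det : ℝ) : ℂ) :=
  D.formula

/-- If `L^{(r)}(E, 1) ≠ 0` then the regulator determinant of a rank-`r` datum is non-zero (since
`c > 0`); with the Gram/non-degeneracy argument for the Néron–Tate pairing this yields `r`
independent points, i.e. `r ≤ rank E(ℚ)` (Gross–Zagier 1986, §V.2, the deduction of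
`rank ≥ 1`). [cite: GrossZagier1986, §V.2] -/
theorem det_ne_zero (D : HigherGrossZagierDatum W r)
    (h : iteratedDeriv r W.entireLFunction 1 ≠ 0) : D.regulatorMatrix.det ≠ 0 := by
  intro hdet
  apply h
  have hf : (r.factorial : ℂ) ≠ 0 := by exact_mod_cast r.factorial_ne_zero
  have := D.formula_eq
  rw [hdet, mul_zero, Complex.ofReal_zero, div_eq_zero_iff] at this
  exact this.resolve_right hf

/-- For `r = r_an(E)`: if the leading coefficient is non-zero (fact `leadingLCoeff_ne_zero` of
`AnalyticRank.lean`) then the regulator determinant of the datum is non-zero.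
[cite: GrossZagier1986, §V.2] -/
theorem det_ne_zero_of_leadingLCoeff_ne_zero (D : HigherGrossZagierDatum W W.analyticRank)
    (h : W.leadingLCoeff ≠ 0) : D.regulatorMatrix.det ≠ 0 := by
  intro hdet
  apply h
  rw [D.leadingLCoeff_eq, hdet, mul_zero, Complex.ofReal_zero]

/-- The regulator matrix is symmetric (`heightPairing_symm`: `⟨P,Q⟩ = (ĥ(P+Q) - ĥ P - ĥ Q)/2`
and `P + Q = Q + P`; Silverman AEC VIII.9). [folklore] -/
theorem regulatorMatrix_isSymm (D : HigherGrossZagierDatum W r) : D.regulatorMatrix.IsSymm := by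
  ext i j
  exact heightPairing_symm _ _

/-- The pairing of the origin with itself vanishes (`ĥ(O) = 0`). [folklore] -/
theorem _root_.WeierstrassCurve.Affine.Point.heightPairing_zero_zero {K : Type*} [Field K]
    [Height.AdmissibleAbsValues K] {V : WeierstrassCurve K} :
    heightPairing (0 : V.toAffine.Point) 0 = 0 := by
  simp [heightPairing, canonicalHeight_zero]

/-- **The trivial datum** (inhabitation profile): if `L^{(r)}(E, 1) = 0` and `r ≠ 0`, then
`Pᵢ := O`, `c := 1` is a rank-`r` datum, both sides of the formula being `0` (the regulator
matrix is the zero matrix). Hence `HigherGrossZagierDatum W r` is informative only when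
`L^{(r)}(E,1) ≠ 0`. [folklore] -/
def trivialDatum (W : WeierstrassCurve ℚ) {r : ℕ} (hr : r ≠ 0)
    (h0 : iteratedDeriv r W.entireLFunction 1 = 0) : HigherGrossZagierDatum W r where
  P := fun _ => 0
  c := 1
  c_pos := one_pos
  formula := by
    obtain ⟨n, rfl⟩ := Nat.exists_eq_succ_of_ne_zero hr
    have hM : (Matrix.of fun (_ : Fin (n + 1)) (_ : Fin (n + 1)) =>
        heightPairing (0 : W.toAffine.Point) 0) = 0 := by
      ext i j
      simp [WeierstrassCurve.Affine.Point.heightPairing_zero_zero]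
    rw [h0, hM, Matrix.det_zero]
    · simp

end HigherGrossZagierDatum

end Literature.EllArith

end
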